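import Summits.SmoothPoincare4.SmoothPoincare4.Theorems.EntropyRungNoncompactShrinkerGapHeatVeryWeakNoncompactAux
import HarnessLib

/-!
# Lions' very weak existence for the static linear heat equation on a complete manifold
# (crux `EntropyRung.NoncompactShrinkerGap`, stmt-SmoothPoincare4-10868, line `collapsed-ends-usc`, v13)

Helper `helper_veryWeakHeat_noncompact` of the registered stub `stub_compactSupportLSI`: the non-compact,
static-metric version of `exists_veryWeak_linearHeat` (`LinearHeatWeakExistence.lean`, written for a closed
manifold and a time-dependent family with density ratio `ρ`). Let `(M, g)` be a Riemannian manifold modelled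
on `ℝⁿ` (Hausdorff, second countable, `T₃` — NOT compact), `Q, G` smooth on `M × ℝ` with `G` compactly
supported, `a < b` and `Q ≥ 1` on `M × [a, b]`. Then there is a measurable `u ∈ L²(V_g ⊗ ds)`, `u = 0` for
`s ∉ (a, b)`, with
`∫ u (−∂ₛζ − Δ_g ζ(·, s) + Qζ) d(V_g ⊗ ds) = ∫_{M×(a,b)} G ζ d(V_g ⊗ ds)`
for every smooth compactly supported `ζ` with `tsupport ζ ⊆ M × (−∞, b)` — a very weak solution of
`∂ₛu = Δ_g u − Qu + G` on `M × (a, b)` with `u(a) = 0` weakly, extended by zero.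

Proof (Trèves 1975, §41, Lemma 41.2 ⇒ Thm. 40.1, exactly as in the tree, with the compactness of `M`
replaced by compact SPATIAL support of the test functions): J.-L. Lions' projection lemma
(`lions_projection`) in `H = L²(M × (a, b), V_g ⊗ ds)` with the test space `Φ` of smooth functions on
`M × ℝ` vanishing off `K × ℝ` for some compact `K ⊆ M` and for `s ≥ b'` for some `b' < b` (a submodule);
every `φ ∈ Φ` and `𝒜φ = −∂ₛφ − Δ_g φ(·, s) + Qφ` is continuous and vanishes off `K × ℝ`, hence lies in
`L²` of the strip (`V_g` is finite on compact sets; no finiteness of `V_g(M)` is used); coercivity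
`‖φ‖² ≤ ⟪𝒜φ, φ⟫` is the energy inequality `energy_le_integral_mul_heatAdjoint_static` of the auxiliary file
(`helper_energyIneq_static`); the embedding constant is `1`; `|∫ Gφ| ≤ ‖G‖₂‖φ‖₂` since `G` has compact
support. A compactly supported `ζ` with `tsupport ζ ⊆ M × (−∞, b)` belongs to `Φ` with
`K = fst(tsupport ζ)`. Everything is proved; no definitions.

References: F. Trèves, *Basic Linear Partial Differential Equations* (1975), §41, Lemma 41.2, (41.7),
Thm. 40.1; J.-L. Lions, *Équations différentielles opérationnelles et problèmes aux limites* (1961).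
-/

noncomputable section

set_option linter.dupNamespace false

open scoped Manifold ContDiff ENNReal NNReal Topology InnerProductSpace
open MeasureTheory Set Filter
open Literature.Geometry.Lorentzian Literature.Geometry.Riemannian

namespace Summit.SmoothPoincare4.SmoothPoincare4.Theorems.NoncompactShrinkerGapHeat

section VeryWeakStatic

variable {n : ℕ} {M : Type*} [TopologicalSpace M] [T2Space M] [SecondCountableTopology M]
  [ChartedSpace (EuclideanSpace ℝ (Fin n)) M] [IsManifold (𝓡 n) ∞ M] [T3Space M] [MeasurableSpace M]
  [BorelSpace M]
  {g : PseudoRiemannianMetric (𝓡 n) ∞ (EuclideanSpace ℝ (Fin n)) (TangentSpace (𝓡 n) : M → Type _)}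

/-- **Existence of a very weak `L²` solution of the static linear heat equation with zero initial data on a
complete manifold** (Lions' projection method, Trèves 1975, §41, proof of Thm. 40.1 via Lemma 41.2 — on a
NON-compact `M`). `(M, g)` Riemannian modelled on `ℝⁿ` (Hausdorff, second countable, `T₃`), `Q, G` smooth on
`M × ℝ` with `G` compactly supported, `a < b`, `Q ≥ 1` on `M × [a, b]`. Then there is a measurable
`u ∈ L²(V_g ⊗ ds)`, zero for `s ∉ (a, b)`, with
`∫ u (−∂ₛζ − Δ_g ζ(·, s) + Qζ) d(V_g ⊗ ds) = ∫_{M×(a,b)} G ζ d(V_g ⊗ ds)` for every smooth compactly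
supported `ζ` with `tsupport ζ ⊆ M × (−∞, b)`. Proof: `lions_projection` in `H = L²(M × (a, b))` with the
test space `Φ` of smooth functions vanishing off `K × ℝ` for some compact `K` and for `s ≥ b'` for some
`b' < b`; coercivity is `energy_le_integral_mul_heatAdjoint_static`, the embedding constant is `1`, and
`|∫ Gφ| ≤ ‖G‖₂ ‖φ‖₂`. [cite: Treves1975, §41, Lemma 41.2 and Thm. 40.1] -/
theorem exists_veryWeak_linearHeat_static (hg : g.IsRiemannian) {Q G : ℝ → M → ℝ}
    (hQ : ContMDiff ((𝓡 n).prod 𝓘(ℝ, ℝ)) 𝓘(ℝ, ℝ) ∞ fun p : M × ℝ ↦ Q p.2 p.1)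
    (hG : ContMDiff ((𝓡 n).prod 𝓘(ℝ, ℝ)) 𝓘(ℝ, ℝ) ∞ fun p : M × ℝ ↦ G p.2 p.1)
    (hGc : HasCompactSupport fun p : M × ℝ ↦ G p.2 p.1) {a b : ℝ} (hab : a < b)
    (hQ1 : ∀ (x : M) (s : ℝ), s ∈ Icc a b → 1 ≤ Q s x) :
    ∃ u : M × ℝ → ℝ, Measurable u ∧ MemLp u 2 (g.riemVolume.prod (volume : Measure ℝ)) ∧
      (∀ p : M × ℝ, p.2 ∉ Ioo a b → u p = 0) ∧
      ∀ ζ : M × ℝ → ℝ, ContMDiff ((𝓡 n).prod 𝓘(ℝ, ℝ)) 𝓘(ℝ, ℝ) ∞ ζ → HasCompactSupport ζ →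
        tsupport ζ ⊆ univ ×ˢ Iio b →
        ∫ p, u p * (-(deriv (fun s ↦ ζ (p.1, s)) p.2) - g.laplaceBeltrami (fun x ↦ ζ (x, p.2)) p.1 +
            Q p.2 p.1 * ζ p) ∂(g.riemVolume.prod (volume : Measure ℝ)) =
          ∫ p in univ ×ˢ Ioo a b, G p.2 p.1 * ζ p ∂(g.riemVolume.prod (volume : Measure ℝ)) := by
  classical
  haveI : LocallyCompactSpace M := ChartedSpace.locallyCompactSpace (EuclideanSpace ℝ (Fin n)) M
  set μ₀ : Measure M := g.riemVolume with hμ₀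
  haveI : IsFiniteMeasureOnCompacts μ₀ := CarrilloNi2009_shrinkerLSI.isFiniteMeasureOnCompacts_riemVolume hg
  have hfam : IsContMDiffFamilyOn ∞ (fun _ : ℝ ↦ g) univ := isContMDiffFamilyOn_const g univ
  set S : Set (M × ℝ) := univ ×ˢ Ioo a b with hS
  have hSm : MeasurableSet S := MeasurableSet.univ.prod measurableSet_Ioo
  set ν : Measure (M × ℝ) := (μ₀.prod (volume : Measure ℝ)).restrict S with hν
  -- the adjoint operator
  set A : (M × ℝ → ℝ) → (M × ℝ → ℝ) := fun φ p ↦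
    -(deriv (fun s ↦ φ (p.1, s)) p.2) - g.laplaceBeltrami (fun x ↦ φ (x, p.2)) p.1 +
      Q p.2 p.1 * φ p with hA
  have hAs : ∀ {φ : M × ℝ → ℝ}, ContMDiff ((𝓡 n).prod 𝓘(ℝ, ℝ)) 𝓘(ℝ, ℝ) ∞ φ →
      ContMDiff ((𝓡 n).prod 𝓘(ℝ, ℝ)) 𝓘(ℝ, ℝ) ∞ (A φ) := fun hφ ↦
    ((contMDiff_deriv_time hφ).neg.sub (contMDiff_laplaceBeltrami_family hfam hφ)).add (hQ.mul hφ)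
  -- `A φ` vanishes off `K × ℝ` when `φ` does
  have hA0 : ∀ {φ : M × ℝ → ℝ} {K : Set M}, IsCompact K → (∀ p : M × ℝ, p.1 ∉ K → φ p = 0) →
      ∀ p : M × ℝ, p.1 ∉ K → A φ p = 0 := by
    intro φ K hK hφK p hp
    have ht : (fun s ↦ φ (p.1, s)) = fun _ ↦ (0 : ℝ) := funext fun s ↦ hφK (p.1, s) hp
    have hev : (fun x ↦ φ (x, p.2)) =ᶠ[𝓝 p.1] fun _ ↦ (0 : ℝ) := by
      filter_upwards [hK.isClosed.isOpen_compl.mem_nhds hp] with x hx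
      exact hφK (x, p.2) hx
    simp only [hA]
    rw [ht, deriv_const, laplaceBeltrami_eq_zero_of_eventuallyEq_zero _ hev, hφK p hp]
    ring
  -- continuous functions vanishing off some `K × ℝ` are in `L²(ν)`
  have hmemS : ∀ {F : M × ℝ → ℝ} {K : Set M}, IsCompact K → Continuous F →
      (∀ p : M × ℝ, p.1 ∉ K → F p = 0) → MemLp F 2 ν := by
    intro F K hK hF hF0
    rw [memLp_two_iff_integrable_sq hF.aestronglyMeasurable]
    have h2 : ∀ p : M × ℝ, p.1 ∉ K → F p ^ 2 = 0 := fun p hp ↦ by rw [hF0 p hp]; ring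
    exact integrableOn_strip_of_continuous_of_vanish hg hK (hF.fun_pow 2) h2 a b
  -- the test space: smooth, vanishing off `K × ℝ` for a compact `K`, and for `s ≥ b'`, some `b' < b`
  set Φ : Submodule ℝ (M × ℝ → ℝ) :=
    { carrier := {φ | ContMDiff ((𝓡 n).prod 𝓘(ℝ, ℝ)) 𝓘(ℝ, ℝ) ∞ φ ∧
        (∃ K : Set M, IsCompact K ∧ ∀ p : M × ℝ, p.1 ∉ K → φ p = 0) ∧
        ∃ b' < b, ∀ p : M × ℝ, b' ≤ p.2 → φ p = 0}
      add_mem' := by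
        rintro φ ψ ⟨hφ, ⟨K₁, hK₁, hK₁0⟩, b₁, hb₁, h₁⟩ ⟨hψ, ⟨K₂, hK₂, hK₂0⟩, b₂, hb₂, h₂⟩
        refine ⟨hφ.add hψ, ⟨K₁ ∪ K₂, hK₁.union hK₂, fun p hp ↦ ?_⟩, max b₁ b₂, max_lt hb₁ hb₂,
          fun p hp ↦ ?_⟩
        · rw [mem_union, not_or] at hp
          simp only [Pi.add_apply, hK₁0 p hp.1, hK₂0 p hp.2, add_zero]
        · simp only [Pi.add_apply, h₁ p ((le_max_left _ _).trans hp), h₂ p ((le_max_right _ _).trans hp),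
            add_zero]
      zero_mem' := ⟨contMDiff_const, ⟨∅, isCompact_empty, fun p _ ↦ rfl⟩, b - 1, by linarith,
        fun p _ ↦ rfl⟩
      smul_mem' := by
        rintro c φ ⟨hφ, ⟨K₁, hK₁, hK₁0⟩, b₁, hb₁, h₁⟩
        refine ⟨(contMDiff_const.mul hφ :), ⟨K₁, hK₁, fun p hp ↦ ?_⟩, b₁, hb₁, fun p hp ↦ ?_⟩
        · change c * φ p = 0
          rw [hK₁0 p hp, mul_zero]
        · change c * φ p = 0
          rw [h₁ p hp, mul_zero] } with hΦ
  have hΦs : ∀ φ : Φ, ContMDiff ((𝓡 n).prod 𝓘(ℝ, ℝ)) 𝓘(ℝ, ℝ) ∞ (φ : M × ℝ → ℝ) := fun φ ↦ φ.2.1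
  have hΦK : ∀ φ : Φ, ∃ K : Set M, IsCompact K ∧ ∀ p : M × ℝ, p.1 ∉ K → (φ : M × ℝ → ℝ) p = 0 :=
    fun φ ↦ φ.2.2.1
  have hΦb : ∀ φ : Φ, ∀ x : M, ∀ s, b ≤ s → (φ : M × ℝ → ℝ) (x, s) = 0 := by
    intro φ x s hs
    obtain ⟨b', hb', h'⟩ := φ.2.2.2
    exact h' (x, s) (hb'.le.trans hs)
  -- the linear maps into `L²(ν)`
  have hmemφ : ∀ φ : Φ, MemLp (φ : M × ℝ → ℝ) 2 ν := fun φ ↦ by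
    obtain ⟨K, hK, hK0⟩ := hΦK φ
    exact hmemS hK (hΦs φ).continuous hK0
  have hmemA : ∀ φ : Φ, MemLp (A φ) 2 ν := fun φ ↦ by
    obtain ⟨K, hK, hK0⟩ := hΦK φ
    exact hmemS hK (hAs (hΦs φ)).continuous (hA0 hK hK0)
  set j : Φ →ₗ[ℝ] Lp ℝ 2 ν :=
    { toFun := fun φ ↦ (hmemφ φ).toLp (φ : M × ℝ → ℝ)
      map_add' := fun φ ψ ↦ MemLp.toLp_add (hmemφ φ) (hmemφ ψ)
      map_smul' := fun c φ ↦ MemLp.toLp_const_smul c (hmemφ φ) } with hj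
  have hAadd : ∀ φ ψ : Φ, A ((φ + ψ : Φ) : M × ℝ → ℝ) = A φ + A ψ := by
    intro φ ψ; funext p
    exact heatAdjoint_static_add Q (hΦs φ) (hΦs ψ) p
  have hAsmul : ∀ (c : ℝ) (φ : Φ), A ((c • φ : Φ) : M × ℝ → ℝ) = c • A φ := by
    intro c φ; funext p
    exact heatAdjoint_static_smul Q (hΦs φ) c p
  set K : Φ →ₗ[ℝ] Lp ℝ 2 ν :=
    { toFun := fun φ ↦ (hmemA φ).toLp (A φ)
      map_add' := fun φ ψ ↦ by
        have h1 : (hmemA (φ + ψ)).toLp (A ((φ + ψ : Φ) : M × ℝ → ℝ)) =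
            ((hmemA φ).add (hmemA ψ)).toLp (A φ + A ψ) :=
          MemLp.toLp_congr _ _ (Eventually.of_forall fun p ↦ by rw [hAadd])
        rw [h1]; exact MemLp.toLp_add (hmemA φ) (hmemA ψ)
      map_smul' := fun c φ ↦ by
        have h1 : (hmemA (c • φ)).toLp (A ((c • φ : Φ) : M × ℝ → ℝ)) =
            ((hmemA φ).const_smul c).toLp (c • A φ) :=
          MemLp.toLp_congr _ _ (Eventually.of_forall fun p ↦ by rw [hAsmul])
        rw [h1]; exact MemLp.toLp_const_smul c (hmemA φ) } with hK
  -- `G` vanishes off `KG × ℝ`, `KG` compact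
  set KG : Set M := Prod.fst '' tsupport (fun p : M × ℝ ↦ G p.2 p.1) with hKG
  have hKGc : IsCompact KG := hGc.isCompact.image continuous_fst
  have hG0 : ∀ p : M × ℝ, p.1 ∉ KG → G p.2 p.1 = 0 := fun p hp ↦
    image_eq_zero_of_notMem_tsupport (f := fun p : M × ℝ ↦ G p.2 p.1) fun h ↦ hp ⟨p, h, rfl⟩
  have hGmem : MemLp (fun p : M × ℝ ↦ G p.2 p.1) 2 ν := hmemS hKGc hG.continuous hG0
  set ℓ : Φ →ₗ[ℝ] ℝ :=
    { toFun := fun φ ↦ ∫ p, G p.2 p.1 * (φ : M × ℝ → ℝ) p ∂ν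
      map_add' := fun φ ψ ↦ by
        have hi : ∀ θ : Φ, Integrable (fun p ↦ G p.2 p.1 * (θ : M × ℝ → ℝ) p) ν := fun θ ↦ by
          have h0 : ∀ p : M × ℝ, p.1 ∉ KG → G p.2 p.1 * (θ : M × ℝ → ℝ) p = 0 := fun p hp ↦ by
            rw [hG0 p hp, zero_mul]
          exact integrableOn_strip_of_continuous_of_vanish hg hKGc
            (hG.continuous.fun_mul (hΦs θ).continuous) h0 a b
        rw [← integral_add (hi φ) (hi ψ)]
        exact integral_congr_ae (Eventually.of_forall fun p ↦ by
          simp only [Submodule.coe_add, Pi.add_apply]; ring)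
      map_smul' := fun c φ ↦ by
        rw [RingHom.id_apply, smul_eq_mul, ← MeasureTheory.integral_const_mul]
        exact integral_congr_ae (Eventually.of_forall fun p ↦ by
          simp only [Submodule.coe_smul, Pi.smul_apply, smul_eq_mul]; ring) } with hℓ
  -- the gauge and the constant
  set nΦ : Φ → ℝ := fun φ ↦ Real.sqrt (∫ p, (φ : M × ℝ → ℝ) p ^ 2 ∂ν) with hnΦ
  set C₁ : ℝ := Real.sqrt (∫ p, G p.2 p.1 ^ 2 ∂ν) with hC₁
  -- (i) coercivity
  have hcoerc : ∀ φ : Φ, 1 * nΦ φ ^ 2 ≤ ⟪K φ, j φ⟫_ℝ := by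
    intro φ
    have hint_eq : ⟪K φ, j φ⟫_ℝ = ∫ p, A φ p * (φ : M × ℝ → ℝ) p ∂ν :=
      inner_toLp_toLp_eq_integral (hmemA φ) (hmemφ φ)
    rw [one_mul, hint_eq, hnΦ]
    dsimp only
    rw [Real.sq_sqrt (integral_nonneg fun p ↦ sq_nonneg _)]
    obtain ⟨K', hK', hK'0⟩ := hΦK φ
    have hen := energy_le_integral_mul_heatAdjoint_static hg hQ hab hQ1 hK' (hΦs φ) hK'0 (hΦb φ)
    rw [hν]
    calc ∫ p in S, (φ : M × ℝ → ℝ) p ^ 2 ∂μ₀.prod (volume : Measure ℝ)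
        ≤ _ := hen
      _ = ∫ p in S, A φ p * (φ : M × ℝ → ℝ) p ∂μ₀.prod (volume : Measure ℝ) :=
          integral_congr_ae (Eventually.of_forall fun p ↦ by simp only [hA]; ring)
  -- (ii) the inclusion is bounded (constant `1`)
  have hemb : ∀ φ : Φ, ‖j φ‖ ≤ 1 * nΦ φ := by
    intro φ
    change ‖(hmemφ φ).toLp (φ : M × ℝ → ℝ)‖ ≤ 1 * nΦ φ
    rw [norm_toLp_two_eq_sqrt, one_mul]
  -- (iii) the functional is bounded (Cauchy–Schwarz)
  have hℓb : ∀ φ : Φ, |ℓ φ| ≤ C₁ * nΦ φ := by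
    intro φ
    change |∫ p, G p.2 p.1 * (φ : M × ℝ → ℝ) p ∂ν| ≤ C₁ * nΦ φ
    have hcs := abs_real_inner_le_norm (hGmem.toLp _) ((hmemφ φ).toLp _)
    rw [inner_toLp_toLp_eq_integral, norm_toLp_two_eq_sqrt, norm_toLp_two_eq_sqrt] at hcs
    exact hcs
  -- Lions' projection lemma
  obtain ⟨U, hU⟩ := Literature.Analysis.PDE.lions_projection K j ℓ nΦ one_pos zero_le_one (Real.sqrt_nonneg _)
    (fun φ ↦ Real.sqrt_nonneg _) hcoerc hemb hℓb
  -- a measurable representative, extended by zero off the strip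
  set Ut : M × ℝ → ℝ := (Lp.memLp U).1.mk U with hUt
  have hUtm : Measurable Ut := (Lp.memLp U).1.stronglyMeasurable_mk.measurable
  have hUUt : (U : M × ℝ → ℝ) =ᵐ[ν] Ut := (Lp.memLp U).1.ae_eq_mk
  have hUt2 : MemLp Ut 2 ν := (Lp.memLp U).ae_eq hUUt
  set u : M × ℝ → ℝ := S.indicator Ut with hu
  refine ⟨u, hUtm.indicator hSm, ?_, ?_, ?_⟩
  · rw [hu, memLp_indicator_iff_restrict hSm]; exact hUt2
  · intro p hp
    rw [hu, indicator_of_notMem (fun h' : p ∈ S ↦ hp h'.2)]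
  · intro ζ hζ hζc hζT
    -- `ζ` belongs to the test space
    have hζΦ : ζ ∈ Φ := by
      refine ⟨hζ, ⟨Prod.fst '' tsupport ζ, hζc.isCompact.image continuous_fst, fun p hp ↦
        image_eq_zero_of_notMem_tsupport fun h ↦ hp ⟨p, h, rfl⟩⟩, ?_⟩
      set Kt : Set ℝ := Prod.snd '' tsupport ζ with hKt
      have hKtc : IsCompact Kt := hζc.isCompact.image continuous_snd
      rcases Kt.eq_empty_or_nonempty with he | hne
      · refine ⟨b - 1, by linarith, fun p _ ↦ ?_⟩
        have : p ∉ tsupport ζ := fun h' ↦ by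
          have : p.2 ∈ Kt := ⟨p, h', rfl⟩
          rw [he] at this; exact this
        exact image_eq_zero_of_notMem_tsupport this
      · obtain ⟨s₀, hs₀, hmax⟩ := hKtc.exists_isMaxOn hne continuous_id.continuousOn
        obtain ⟨p₀, hp₀, rfl⟩ := hs₀
        have hs₀b : p₀.2 < b := (hζT hp₀).2
        refine ⟨(p₀.2 + b) / 2, by linarith, fun p hp ↦ ?_⟩
        have : p ∉ tsupport ζ := fun h' ↦ by
          have hle : p.2 ≤ p₀.2 := hmax ⟨p, h', rfl⟩
          linarith
        exact image_eq_zero_of_notMem_tsupport this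
    have key := hU ⟨ζ, hζΦ⟩
    -- unfold both sides
    have hKζ : ⟪U, K ⟨ζ, hζΦ⟩⟫_ℝ = ∫ p, Ut p * A ζ p ∂ν := by
      have h1 : ⟪U, K ⟨ζ, hζΦ⟩⟫_ℝ = ⟪hUt2.toLp Ut, (hmemA ⟨ζ, hζΦ⟩).toLp (A ζ)⟫_ℝ := by
        congr 1
        exact (Lp.toLp_coeFn U (Lp.memLp U)).symm.trans (MemLp.toLp_congr _ _ hUUt)
      rw [h1, inner_toLp_toLp_eq_integral]
    rw [hKζ] at key
    change ∫ p, Ut p * A ζ p ∂ν = ∫ p, G p.2 p.1 * ζ p ∂ν at key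
    rw [hν] at key
    have hlhs : ∫ p, u p * A ζ p ∂μ₀.prod (volume : Measure ℝ) =
        ∫ p in S, Ut p * A ζ p ∂μ₀.prod (volume : Measure ℝ) := by
      rw [← MeasureTheory.integral_indicator hSm]
      refine integral_congr_ae (Eventually.of_forall fun p ↦ ?_)
      simp only [hu]
      by_cases hp : p ∈ S
      · rw [indicator_of_mem hp, indicator_of_mem hp]
      · rw [indicator_of_notMem hp, indicator_of_notMem hp, zero_mul]
    rw [hlhs]
    exact key

end VeryWeakStatic

/-- **Registered helper `helper_veryWeakHeat_noncompact`** (line `collapsed-ends-usc`): Lions' very weak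
`L²` existence for the static linear heat equation `∂ₛu − Δ_g u + Qu = G` with zero initial data at `s = a`
on a (non-compact) Riemannian manifold `(M, g)` modelled on `ℝⁿ`, for a compactly supported smooth source
`G` and `Q ≥ 1` on `M × [a, b]` (`exists_veryWeak_linearHeat_static`).
[cite: Treves1975, §41, Lemma 41.2 and Thm. 40.1] -/
theorem helper_veryWeakHeat_noncompact : ∀ (n : ℕ) (M : Type*) [TopologicalSpace M] [T2Space M] [SecondCountableTopology M] [ChartedSpace (EuclideanSpace ℝ (Fin n)) M] [IsManifold (𝓡 n) ∞ M] [T3Space M] [MeasurableSpace M] [BorelSpace M] (g : PseudoRiemannianMetric (𝓡 n) ∞ (EuclideanSpace ℝ (Fin n)) (TangentSpace (𝓡 n) : M → Type _)), g.IsRiemannian → ∀ (Q G : ℝ → M → ℝ), ContMDiff ((𝓡 n).prod 𝓘(ℝ, ℝ)) 𝓘(ℝ, ℝ) ∞ (fun p : M × ℝ ↦ Q p.2 p.1) → ContMDiff ((𝓡 n).prod 𝓘(ℝ, ℝ)) 𝓘(ℝ, ℝ) ∞ (fun p : M × ℝ ↦ G p.2 p.1) → HasCompactSupport (fun p : M ×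 ℝ ↦ G p.2 p.1) → ∀ (a b : ℝ), a < b → (∀ (x : M) (s : ℝ), s ∈ Icc a b → 1 ≤ Q s x) → ∃ u : M × ℝ → ℝ, Measurable u ∧ MemLp u 2 (g.riemVolume.prod (volume : Measure ℝ)) ∧ (∀ p : M × ℝ, p.2 ∉ Ioo a b → u p = 0) ∧ ∀ ζ : M × ℝ → ℝ, ContMDiff ((𝓡 n).prod 𝓘(ℝ, ℝ)) 𝓘(ℝ, ℝ) ∞ ζ → HasCompactSupport ζ → tsupport ζ ⊆ univ ×ˢ Iio b → ∫ p, u p * (-(deriv (fun s ↦ ζ (p.1, s)) p.2) - g.laplaceBeltrami (fun x ↦ ζ (x, p.2)) p.1 + Q p.2 p.1 * ζ p) ∂(g.riemVolume.prod (volume : Measure ℝ)) = ∫ p in univ ×ˢ Ioo a b, G p.2 p.1 * ζ p ∂(g.riemVolume.prod (volume : Measure ℝ)) := by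
  intro n M _ _ _ _ _ _ _ _ g hg Q G hQ hG hGc a b hab hQ1
  exact exists_veryWeak_linearHeat_static hg hQ hG hGc hab hQ1


end Summit.SmoothPoincare4.SmoothPoincare4.Theorems.NoncompactShrinkerGapHeat

end
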